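import Mathlib

/-!
# SoloBlind — the "half branch locus" class: a Lucas identity and dihedral fixed vectors

In the Prym description of the 2-Eisenstein cells of level `2N` on the Shimura curve
`X^{2N}` (THEOREM Π of the seat's notes), the double cover `X^{2N}/w_{2N} → X^{2N}/W` is
branched over the CM locus `B_K`, a torsor under the cyclic group `Cl(K)/⟨c₀⟩ ≅ ℤ/2a × C_odd`
(`K = ℚ(√-N)`, `4a = |Cl(K)[2^∞]|`) with dihedral Galois action, and the Galois-invariant part
of `E(B_K) = (even subsets of B_K)/⟨B_K⟩` is computed in `𝔽₂[σ]/(σ^{2a} - 1) = 𝔽₂[y]/(y^{2a})`,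
`y = 1 + σ`: the invariant line is spanned by `y^{2a-2} = (1 + σ²)^{a-1}`, and the point is that
for `a = 2^k` this element is the indicator of the even positions `∑_{j<a} σ^{2j}` ("half of the
branch locus"), which is an even subset iff `a ≥ 2`.

* `soloBlind_lucas_half` is the polynomial identity behind this, valid in `(ZMod 2)[X]` for
  every `k`: `(1 + X²)^(2^k - 1) = ∑_{j < 2^k} X^{2j}` (all binomial coefficients
  `C(2^k - 1, j)` are odd — Lucas).
* `soloBlind_dihedralHalf_two/four/eight` are the finite statements for `2a = 2, 4, 8`
  (the cases `a = 1, 2, 4`, i.e. `8 ∤ h(-4N)`, `8 ∥ h(-4N)`, `16 ∥ h(-4N)`): among the bit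
  vectors of length `2a`, those of even weight that are fixed modulo the all-ones vector by the
  rotation and by the reflection `i ↦ -i` are exactly `0`, all-ones and — only when `a ≥ 2` —
  the even-position indicator and its complement. So `E(B_K)` has no dihedral-fixed class for
  `a = 1` and exactly one for `a = 2, 4`.
-/

namespace Summit.Langlands.Langlands.Theorems

open Polynomial Finset

/-- Frobenius in characteristic two, iterated: `(1 + Y)^(2^k) = 1 + Y^(2^k)` in `(ZMod 2)[X]`. -/
theorem soloBlind_one_add_pow_two_pow (Y : (ZMod 2)[X]) (k : ℕ) :
    (1 + Y) ^ (2 ^ k) = 1 + Y ^ (2 ^ k) := by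
  induction k with
  | zero => simp
  | succ k ih =>
      have h2 : (2 : (ZMod 2)[X]) = 0 := CharTwo.two_eq_zero
      rw [pow_succ, pow_mul, ih, add_sq, mul_one, ← pow_mul, one_pow, h2, zero_mul, add_zero]

/-- LUCAS IDENTITY ("half of the branch locus"): in `(ZMod 2)[X]`,
`(1 + X²)^(2^k - 1) = ∑_{j < 2^k} (X²)^j` for every `k`. -/
theorem soloBlind_lucas_half (k : ℕ) :
    ((1 : (ZMod 2)[X]) + X ^ 2) ^ (2 ^ k - 1) = ∑ j ∈ range (2 ^ k), (X ^ 2) ^ j := by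
  set Y : (ZMod 2)[X] := X ^ 2 with hY
  have hne : Y + 1 ≠ 0 := by
    rw [hY, ← C_1]
    exact (monic_X_pow_add_C (1 : ZMod 2) two_ne_zero).ne_zero
  apply mul_right_cancel₀ hne
  have hk : 2 ^ k - 1 + 1 = 2 ^ k := Nat.sub_add_cancel Nat.one_le_two_pow
  have lhs : (1 + Y) ^ (2 ^ k - 1) * (Y + 1) = 1 + Y ^ (2 ^ k) := by
    rw [add_comm Y 1, ← pow_succ, hk, soloBlind_one_add_pow_two_pow]
  have rhs : (∑ j ∈ range (2 ^ k), Y ^ j) * (Y + 1) = 1 + Y ^ (2 ^ k) := by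
    rw [← CharTwo.sub_eq_add, geom_sum_mul, CharTwo.sub_eq_add, add_comm]
  rw [lhs, rhs]

/-! ### The finite dihedral statements (`2a = 2, 4, 8`) -/

/-- Hamming weight of the low `n` bits of `v`. -/
def sbWeight : ℕ → ℕ → ℕ
  | 0, _ => 0
  | n + 1, v => (if v.testBit n then 1 else 0) + sbWeight n v

/-- Reflection `i ↦ -i (mod n)` on bit positions, accumulated over the low `m` bits. -/
def sbReflAux (n : ℕ) : ℕ → ℕ → ℕ
  | 0, _ => 0
  | m + 1, v => (if v.testBit m then 2 ^ ((n - m) % n) else 0) + sbReflAux n m v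

/-- Reflection `i ↦ -i (mod n)` of an `n`-bit vector. -/
def sbRefl (n v : ℕ) : ℕ := sbReflAux n n v

/-- Rotation by one position of an `n`-bit vector. -/
def sbRot (n v : ℕ) : ℕ := (v % 2 ^ (n - 1)) * 2 + v / 2 ^ (n - 1)

/-- `v` (an `n`-bit vector) has even weight and is fixed, modulo the all-ones vector `2^n - 1`,
by the rotation and by the reflection: i.e. its class in `(even subsets)/⟨all⟩` is fixed by the
dihedral group of order `2n`. -/
def sbDihedralFixedMod (n v : ℕ) : Bool :=
  (sbWeight n v % 2 == 0) &&
  (sbRot n v == v || sbRot n v == v ^^^ (2 ^ n - 1)) &&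
  (sbRefl n v == v || sbRefl n v == v ^^^ (2 ^ n - 1))

/-- `2a = 2` (`a = 1`): only `0` and all-ones — no fixed class in `E(B_K)`. -/
theorem soloBlind_dihedralHalf_two :
    (List.range (2 ^ 2)).filter (sbDihedralFixedMod 2) = [0, 3] := by decide

/-- `2a = 4` (`a = 2`): `0`, the even-position indicator `0101₂ = 5`, its complement `10`, and
all-ones — exactly one non-zero fixed class in `E(B_K)`, the class of "half of `B_K`". -/
theorem soloBlind_dihedralHalf_four :
    (List.range (2 ^ 4)).filter (sbDihedralFixedMod 4) = [0, 5, 10, 15] := by decide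

/-- `2a = 8` (`a = 4`): `0`, `01010101₂ = 85`, its complement `170`, and all-ones. -/
theorem soloBlind_dihedralHalf_eight :
    (List.range (2 ^ 8)).filter (sbDihedralFixedMod 8) = [0, 85, 170, 255] := by decide

/-- The even-position indicators are the values of the Lucas polynomial at `X = 2`:
`∑_{j<a} 4^j = 5, 85` for `a = 2, 4` (and `1` for `a = 1`, which has odd weight). -/
theorem soloBlind_evenIndicator_values :
    (∑ j ∈ range 1, 4 ^ j = 1) ∧ (∑ j ∈ range 2, 4 ^ j = 5) ∧ (∑ j ∈ range 4, 4 ^ j = 85) := by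
  decide

end Summit.Langlands.Langlands.Theorems
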